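import Summits.QuantumFields.YangMills.Theorems.LuscherReductionTwistedTraceScalingBODefect
import HarnessLib

/-!
# R44 — THE `L²(w)` (B-OD) DOOR IS AN EQUIVALENCE, AND WHAT IT MAKES NECESSARY: `hOD` forces every orthogonalised quasimode defect to be `(b·Λ)`-small, and the transfer of a
# BO state may not LEAK out of the profile's support ball (crux `TwistedTraceScaling` stmt-QuantumFields-20203, skeleton «twolattice», S-BASE C4-CORE (B-OD); standing
# disprover, cycle 36)

Lane A's new door `…BODefect.hOD_of_defect` (p679261) derives the field `hOD` of `RecordAnalyticInput` from an `L²(w)` QUASIMODE DEFECT: eventually every admissible slow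
amplitude `φ` has `K̃(boFun φ Ω)(U) = (boFun ψ Ω U + E U)·w U` on `{χ ≠ 0}` with `∫ E²w ≤ (b·Λ)²·‖boFun φ Ω‖²_w`.  This file records, as kernel-checked theorems, that the door
loses NOTHING, and what it therefore makes NECESSARY for any profile family:
* §1 `le_sq_mul_of_le_mul_sqrt` (`T ≤ c·√A·√T ⇒ T ≤ c²·A`); ★ `tubeCross_eq_tubeNormSq_of_defect`: if `E` is fibrewise `w`-orthogonal to `Ω` and the decomposition holds on
  `supp E`, then `X(E, boFun φ Ω) = ∫ E²w` EXACTLY (the coefficient `ψ` drops out, `integral_mul_boFun_mul_eq_zero`).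
* §2 ★★★ `defect_sq_le_of_hOD_pair` — THE CONVERSE OF THE DOOR: the `hOD` inequality for the single pair `(φ, v := E)` already forces `∫ E²w ≤ (b·Λ)²·‖boFun φ Ω‖²_w`.
  With p679261: `(∃ ψ E: decomposition on {χ≠0} ∧ ∫E²w ≤ (bΛ)²A) ⇒ hOD ⇒ (∀ fibrewise-orthogonal decompositions: ∫E²w ≤ (bΛ)²A)` — the `L²(w)` door is an `↔`, the
  orthogonalised (BO-projected) defect is the optimal one, and to REFUTE `hOD` for a given profile it suffices to bound ONE orthogonalised defect from below.
* §3 ★ `leak_admissible`, ★★★ `leak_sq_le_of_hOD_pair` — THE LEAK TEST: for a measurable `S ⊆ {Ω ∘ relLinkVec = 0} ∩ {w ≥ w₀}` (`w₀ > 0`) and bounded measurable `f`,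
  `v_S := 𝟙_S·K̃f/w` is bounded, measurable and fibrewise `w`-orthogonal to `Ω` (the factor `Ω(v̂')` vanishes on `S`), with `X(v_S, f) = ‖v_S‖²_w = ∫_S (K̃f)²/w`; so the
  `hOD` inequality for the pair `(φ, v_S)` (`f = boFun φ Ω`, `S ⊆ {χ ≠ 0}`) forces `∫_S K̃(boFun φ Ω)²/w ≤ (b·Λ)²·‖boFun φ Ω‖²_w` — no `ψ`, no model input.
* §4 the `∀ᶠ β` family forms taking LITERALLY the binder shape of the field `hOD` as hypothesis (★★★ `defect_sq_le_of_hOD`, ★★★ `leak_sq_le_of_hOD`; any profile family `Ω`,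
  weight `softWeight (χ β)`, window `δ₁`, level `Λ`, rate `b` — the data of `hOD_of_defect`), and
* §5 their instances for every `A : RecordAnalyticInput L s M` (★★★ `record_defect_sq_le`, ★★★ `record_leak_sq_le`): weight `softWeight (recordChi L s 43 M β)`, window
  `recordDelta1 L s β`, level `σ β·λ₀((L:ℝ)³β)`, rate `A.b β` (with `A.hb_small : b β² = o(λ_b)`).
READING (for the (OD) pen, COARSE-DESIGN §27).  (i) Nothing is lost by the defect formulation: `(Q-L²)_⊥ ⟺ hOD`.  (ii) LEAK NECESSITY: `A.hΩr` puts `supp (Ω β)` in the ball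
`‖x‖ ≤ r β`, so the whole shell `{χ_β ≠ 0} ∩ {r β < ‖relLinkVec U‖}` of the fat tube is a leak set, and there `w = N/χ ≥ N ≥ N̄(1 − Cδ²) > 0` eventually
(`…FPWeightCore.fpWeight_core_constant_pow`); hence every admissible profile family must satisfy, for all admissible `φ` and eventually in `β`,
  `∫_{χ_β ≠ 0, ‖x'‖ > r β} K̃_β(φ⊗Ω_β)²·χ_β/N_β ≤ (b β·σ β·λ₀)²·‖φ⊗Ω_β‖²_{w_β}`,   `b β² = o(λ_b((L:ℝ)³β))`:
the one-step transfer of the BO state must not leak out of the support ball.  [model, not landed] For a profile truncated at `r = c·β^{-1/2}`, `c = O(1)`, the transverse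
Mehler step (contraction `e^{-ω}`, `cosh ω = 1 + λ/2`, diffusion width `Θ(β^{-1/2})`) leaks a `β`-INDEPENDENT fraction of `‖φ⊗Ω‖²_w`, so `b ≥ b₀(c) > 0` and `hb_small`
fails: `r β·β^{1/2} → ∞` is NECESSARY for (B-OD) in the record architecture (a transfer-side companion of the static necessities R40 `…Negative.StiffCaptureNecessity` and R42
`…Negative.StiffGapProfileDominance`); with `A.hr_small` (`12·|sites|·r β < β^{-s}`) the admissible support radii live in the window `β^{-1/2} ≪ r β ≪ β^{-s}`
(non-empty iff `s < 1/2`; lane A's `r_B = min(1/40, β^{-1/2}·btLog β)` sits inside, leak `e^{−Θ(log² β)}`).  (iii) A REFUTATION of `hOD(Ω)` needs a LOWER bound on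
`∫_S K̃(φ⊗Ω)²/w` (or on one orthogonalised defect) for one `φ`; the tree offers only the `e^{−cβ}`-type pointwise kernel sandwich, useless at large `β` — the Gaussian
(Mehler) evaluation lane A owes for the upper bound is equally owed for any lower bound: no cheap kill (cycle-36 verdict).
HONEST FRAMING: necessity / tightness lemmas about the HYPOTHESES of a landed reduction (which remains a true implication); nothing landed is contradicted; (B-OD), (B-ST),
C4-CORE OPEN; stub of a child of the CONDITIONAL reduction route R2b1 (`LuscherReduction`); not `¬TwistedTraceScaling`, not infinite volume, not a gap, not Clay.
-/

set_option autoImplicit false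

noncomputable section

open MeasureTheory Real Filter Topology
open scoped BigOperators
open Literature.MathematicalPhysics.QuantumFieldTheory hiding SU2
open Literature.MathematicalPhysics.QuantumLattice

namespace Summit.QuantumFields.YangMills.Theorems.TwistedTraceScaling.Negative.R44

open Summit.QuantumFields.YangMills.Theorems.FemtoTransferGap
open Summit.QuantumFields.YangMills.Theorems.FemtoTransferGap.TwoLattice
open Summit.QuantumFields.YangMills.Theorems.FemtoTransferGap.TwoLattice.Avg
open Summit.QuantumFields.YangMills.Theorems.FemtoTransferGap.TwoLattice.ConstTube
open Summit.QuantumFields.YangMills.Theorems.FemtoTransferGap.TwoLattice.Stiff (LinkSpace)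

variable {L : ℕ} [NeZero L]

/-! ## §1 The pairing with an orthogonal defect is its squared norm -/

/-- `T ≤ c·√A·√T` with `T, A, c ≥ 0` forces `T ≤ c²·A`. [folklore] -/
theorem le_sq_mul_of_le_mul_sqrt {T A c : ℝ} (hT : 0 ≤ T) (hA : 0 ≤ A) (hc : 0 ≤ c) (h : T ≤ c * Real.sqrt A * Real.sqrt T) : T ≤ c ^ 2 * A := by
  have hsT : 0 ≤ Real.sqrt T := Real.sqrt_nonneg T
  have hsA : 0 ≤ Real.sqrt A := Real.sqrt_nonneg A
  have hTT : Real.sqrt T * Real.sqrt T = T := Real.mul_self_sqrt hT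
  have hAA : Real.sqrt A * Real.sqrt A = A := Real.mul_self_sqrt hA
  rcases eq_or_lt_of_le hsT with h0 | hpos
  · have hT0 : T = 0 := by rw [← hTT, ← h0, mul_zero]
    rw [hT0]; positivity
  · have h1 : Real.sqrt T ≤ c * Real.sqrt A := by
      have h2 : Real.sqrt T * Real.sqrt T ≤ c * Real.sqrt A * Real.sqrt T := by rw [hTT]; exact h
      exact le_of_mul_le_mul_right h2 hpos
    calc T = Real.sqrt T * Real.sqrt T := hTT.symm
      _ ≤ c * Real.sqrt A * (c * Real.sqrt A) := mul_le_mul h1 h1 hsT (mul_nonneg hc hsA)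
      _ = c ^ 2 * (Real.sqrt A * Real.sqrt A) := by ring
      _ = c ^ 2 * A := by rw [hAA]

/-- ★ **The pairing of the BO state with a fibrewise-orthogonal defect is the defect's squared norm.**  If `E` is fibrewise `w`-orthogonal to `Ω` (`∀ u, fibreInner L w Ω E u = 0`)
and `K̃(boFun φ Ω)(U) = (boFun ψ Ω U + E U)·w U` on `supp E` (bounded measurable `Ω, w, E, ψ`), then `X(E, boFun φ Ω) = ∫ E²w` — the coefficient `ψ` drops out.
[cite: SjostrandZworski2007, §2] -/
theorem tubeCross_eq_tubeNormSq_of_defect (β : ℝ) {Ω : LinkSpace L → ℝ} (hΩm : Measurable Ω) {CΩ : ℝ} (hCΩ : ∀ x, |Ω x| ≤ CΩ)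
    {w : GaugeConfig 3 L SU2 → ℝ} (hwm : Measurable w) {Cw : ℝ} (hCw : ∀ U, |w U| ≤ Cw) (φ : GaugeConfig 3 1 SU2 → ℝ)
    {E : GaugeConfig 3 L SU2 → ℝ} (hEm : Measurable E) {CE : ℝ} (hCE : ∀ U, |E U| ≤ CE) (horth : ∀ u, fibreInner L w Ω E u = 0)
    {ψ : GaugeConfig 3 1 SU2 → ℝ} (hψm : Measurable ψ) {Cψ : ℝ} (hCψ : ∀ u, |ψ u| ≤ Cψ)
    (hF : ∀ U, E U ≠ 0 → ∫ V, avgKernel β U V * boFun L φ Ω V ∂configMeasure SU2 L = (boFun L ψ Ω U + E U) * w U) :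
    tubeCross β E (boFun L φ Ω) = tubeNormSq w E := by
  rw [tubeCross_eq_integral_mul]
  unfold tubeNormSq
  have hpt : (fun U => E U * ∫ V, avgKernel β U V * boFun L φ Ω V ∂configMeasure SU2 L) = fun U => E U * boFun L ψ Ω U * w U + E U ^ 2 * w U := by
    funext U
    by_cases hU : E U = 0
    · rw [hU]; ring
    · rw [hF U hU]; ring
  have hCE0 : 0 ≤ CE := (abs_nonneg _).trans (hCE 1)
  have hB0 : 0 ≤ Cψ * CΩ := (abs_nonneg _).trans (abs_boFun_le L hCψ hCΩ (1 : GaugeConfig 3 L SU2))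
  have i1 : Integrable (fun U => E U * boFun L ψ Ω U * w U) (configMeasure SU2 L) :=
    integrable_of_measurable_abs_le (configMeasure SU2 L) ((hEm.mul (measurable_boFun L hψm hΩm)).mul hwm) (C := CE * (Cψ * CΩ) * Cw) fun U => by
      rw [abs_mul, abs_mul]
      exact mul_le_mul (mul_le_mul (hCE U) (abs_boFun_le L hCψ hCΩ U) (abs_nonneg _) hCE0) (hCw U) (abs_nonneg _) (mul_nonneg hCE0 hB0)
  have i2 : Integrable (fun U => E U ^ 2 * w U) (configMeasure SU2 L) :=
    integrable_of_measurable_abs_le (configMeasure SU2 L) ((hEm.pow_const 2).mul hwm) (C := CE ^ 2 * Cw) fun U => by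
      rw [abs_mul, abs_pow]
      exact mul_le_mul (pow_le_pow_left₀ (abs_nonneg _) (hCE U) 2) (hCw U) (abs_nonneg _) (pow_nonneg hCE0 2)
  rw [hpt, integral_add i1 i2, integral_mul_boFun_mul_eq_zero hΩm hCΩ hwm hCw hEm hCE horth hψm hCψ, zero_add]

/-! ## §2 ★★★ The converse of the door: `hOD` for the pair `(φ, E)` bounds the orthogonalised defect -/

/-- ★★★ **THE `L²(w)` DOOR IS AN EQUIVALENCE.**  With the data of `tubeCross_eq_tubeNormSq_of_defect` and `w ≥ 0`: if the `hOD` inequality holds for the single pair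
`(φ, v := E)` — `|X(E, boFun φ Ω)| ≤ b·Λ·√(‖boFun φ Ω‖²_w)·√(‖E‖²_w)`, `b, Λ ≥ 0` — then `∫ E²w ≤ (b·Λ)²·‖boFun φ Ω‖²_w`.  Converse of
`…BODefect.tubeCross_boFun_le_hOD_of_defect` (p679261). [cite: SjostrandZworski2007, §2] -/
theorem defect_sq_le_of_hOD_pair (β : ℝ) {Ω : LinkSpace L → ℝ} (hΩm : Measurable Ω) {CΩ : ℝ} (hCΩ : ∀ x, |Ω x| ≤ CΩ)
    {w : GaugeConfig 3 L SU2 → ℝ} (hwm : Measurable w) {Cw : ℝ} (hCw : ∀ U, |w U| ≤ Cw) (hw0 : ∀ U, 0 ≤ w U) (φ : GaugeConfig 3 1 SU2 → ℝ)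
    {E : GaugeConfig 3 L SU2 → ℝ} (hEm : Measurable E) {CE : ℝ} (hCE : ∀ U, |E U| ≤ CE) (horth : ∀ u, fibreInner L w Ω E u = 0)
    {ψ : GaugeConfig 3 1 SU2 → ℝ} (hψm : Measurable ψ) {Cψ : ℝ} (hCψ : ∀ u, |ψ u| ≤ Cψ)
    (hF : ∀ U, E U ≠ 0 → ∫ V, avgKernel β U V * boFun L φ Ω V ∂configMeasure SU2 L = (boFun L ψ Ω U + E U) * w U)
    {b Λ : ℝ} (hb : 0 ≤ b) (hΛ : 0 ≤ Λ)
    (hODpair : |tubeCross β E (boFun L φ Ω)| ≤ b * Λ * Real.sqrt (tubeNormSq w (boFun L φ Ω)) * Real.sqrt (tubeNormSq w E)) :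
    tubeNormSq w E ≤ (b * Λ) ^ 2 * tubeNormSq w (boFun L φ Ω) := by
  have hX := tubeCross_eq_tubeNormSq_of_defect β hΩm hCΩ hwm hCw φ hEm hCE horth hψm hCψ hF
  have hT0 : 0 ≤ tubeNormSq w E := tubeNormSq_nonneg' hw0 _
  have hA0 : 0 ≤ tubeNormSq w (boFun L φ Ω) := tubeNormSq_nonneg' hw0 _
  rw [hX, abs_of_nonneg hT0] at hODpair
  exact le_sq_mul_of_le_mul_sqrt hT0 hA0 (mul_nonneg hb hΛ) hODpair

/-! ## §3 ★★★ The leak test: `hOD` bounds the transfer of the BO state outside the support of the profile -/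

/-- ★ **The leak test vector is admissible.**  For a measurable `S ⊆ {Ω ∘ relLinkVec = 0} ∩ {w ≥ w₀}` (`w₀ > 0`) and bounded measurable `f`, the function
`v_S := 𝟙_S·K̃f/w` is measurable, bounded, fibrewise `w`-orthogonal to `Ω` (on `S` the factor `Ω(v̂') = Ω(relLinkVec (orthoTube u' v'))` vanishes, `π`-a.e.), and
`X(v_S, f) = ‖v_S‖²_w = ∫_S (K̃f)²/w`. [folklore] -/
theorem leak_admissible (β : ℝ) (Ω : LinkSpace L → ℝ) {w : GaugeConfig 3 L SU2 → ℝ} (hwm : Measurable w)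
    {f : GaugeConfig 3 L SU2 → ℝ} (hfm : Measurable f) {Cf : ℝ} (hCf : ∀ U, |f U| ≤ Cf)
    {S : Set (GaugeConfig 3 L SU2)} (hS : MeasurableSet S) (hSΩ : ∀ U ∈ S, Ω (relLinkVec L U) = 0) {w₀ : ℝ} (hw₀ : 0 < w₀) (hSw : ∀ U ∈ S, w₀ ≤ w U) :
    Measurable (S.indicator fun U => (∫ V, avgKernel β U V * f V ∂configMeasure SU2 L) / w U) ∧
      (∃ C : ℝ, ∀ U, |S.indicator (fun U => (∫ V, avgKernel β U V * f V ∂configMeasure SU2 L) / w U) U| ≤ C) ∧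
      (∀ u, fibreInner L w Ω (S.indicator fun U => (∫ V, avgKernel β U V * f V ∂configMeasure SU2 L) / w U) u = 0) ∧
      tubeCross β (S.indicator fun U => (∫ V, avgKernel β U V * f V ∂configMeasure SU2 L) / w U) f =
        ∫ U in S, (∫ V, avgKernel β U V * f V ∂configMeasure SU2 L) ^ 2 / w U ∂configMeasure SU2 L ∧
      tubeNormSq w (S.indicator fun U => (∫ V, avgKernel β U V * f V ∂configMeasure SU2 L) / w U) =
        ∫ U in S, (∫ V, avgKernel β U V * f V ∂configMeasure SU2 L) ^ 2 / w U ∂configMeasure SU2 L := by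
  obtain ⟨hFm, ⟨M, hM⟩, -⟩ := integral_avgKernel_mul_props β hfm hCf
  have hM0 : 0 ≤ M := (abs_nonneg _).trans (hM 1)
  refine ⟨(hFm.div hwm).indicator hS, ⟨M / w₀, fun U => ?_⟩, fun u => ?_, ?_, ?_⟩
  · by_cases hU : U ∈ S
    · rw [Set.indicator_of_mem hU]
      have hwU : w₀ ≤ w U := hSw U hU
      rw [abs_div, abs_of_pos (hw₀.trans_le hwU)]
      exact div_le_div₀ hM0 (hM U) hw₀ hwU
    · rw [Set.indicator_of_notMem hU, abs_zero]; positivity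
  · unfold fibreInner
    have hae : ∀ᵐ v ∂orthoTransverse L, v ∈ capBalancedSet L := by rw [ae_iff]; exact orthoTransverse_compl_capBalancedSet L
    refine integral_eq_zero_of_ae (hae.mono fun v hv => ?_)
    simp only [Pi.zero_apply]
    by_cases hU : orthoTube L u v ∈ S
    · have h0 : Ω (linkEmbed L v) = 0 := by rw [← relLinkVec_orthoTube L u hv]; exact hSΩ _ hU
      rw [h0, mul_zero, zero_mul]
    · rw [Set.indicator_of_notMem hU, zero_mul, zero_mul]
  · rw [tubeCross_eq_integral_mul, ← integral_indicator hS]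
    refine integral_congr_ae (ae_of_all _ fun U => ?_)
    dsimp only
    by_cases hU : U ∈ S
    · rw [Set.indicator_of_mem hU, Set.indicator_of_mem hU]; ring
    · rw [Set.indicator_of_notMem hU, Set.indicator_of_notMem hU, zero_mul]
  · unfold tubeNormSq
    rw [← integral_indicator hS]
    refine integral_congr_ae (ae_of_all _ fun U => ?_)
    dsimp only
    by_cases hU : U ∈ S
    · rw [Set.indicator_of_mem hU, Set.indicator_of_mem hU]
      have hw : w U ≠ 0 := (hw₀.trans_le (hSw U hU)).ne'
      field_simp
    · rw [Set.indicator_of_notMem hU, Set.indicator_of_notMem hU]; ring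

/-- ★★★ **THE LEAK TEST.**  If `w ≥ 0` and the `hOD` inequality holds for the pair `(f, v_S)` of `leak_admissible` — `|X(v_S, f)| ≤ b·Λ·√(‖f‖²_w)·√(‖v_S‖²_w)`, `b, Λ ≥ 0` —
then `∫_S (K̃f)²/w ≤ (b·Λ)²·‖f‖²_w`: the transfer `K̃f` may not leak, in `L²(1/w)`, onto a set where the profile factor vanishes. [cite: SjostrandZworski2007, §2] -/
theorem leak_sq_le_of_hOD_pair (β : ℝ) (Ω : LinkSpace L → ℝ) {w : GaugeConfig 3 L SU2 → ℝ} (hwm : Measurable w) (hw0 : ∀ U, 0 ≤ w U)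
    {f : GaugeConfig 3 L SU2 → ℝ} (hfm : Measurable f) {Cf : ℝ} (hCf : ∀ U, |f U| ≤ Cf)
    {S : Set (GaugeConfig 3 L SU2)} (hS : MeasurableSet S) (hSΩ : ∀ U ∈ S, Ω (relLinkVec L U) = 0) {w₀ : ℝ} (hw₀ : 0 < w₀) (hSw : ∀ U ∈ S, w₀ ≤ w U)
    {b Λ : ℝ} (hb : 0 ≤ b) (hΛ : 0 ≤ Λ)
    (hODpair : |tubeCross β (S.indicator fun U => (∫ V, avgKernel β U V * f V ∂configMeasure SU2 L) / w U) f| ≤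
      b * Λ * Real.sqrt (tubeNormSq w f) * Real.sqrt (tubeNormSq w (S.indicator fun U => (∫ V, avgKernel β U V * f V ∂configMeasure SU2 L) / w U))) :
    ∫ U in S, (∫ V, avgKernel β U V * f V ∂configMeasure SU2 L) ^ 2 / w U ∂configMeasure SU2 L ≤ (b * Λ) ^ 2 * tubeNormSq w f := by
  obtain ⟨-, -, -, hX, hN⟩ := leak_admissible β Ω hwm hfm hCf hS hSΩ hw₀ hSw
  have hT0 : 0 ≤ tubeNormSq w (S.indicator fun U => (∫ V, avgKernel β U V * f V ∂configMeasure SU2 L) / w U) := tubeNormSq_nonneg' hw0 _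
  have hA0 : 0 ≤ tubeNormSq w f := tubeNormSq_nonneg' hw0 _
  rw [hX, ← hN, abs_of_nonneg hT0] at hODpair
  rw [← hN]
  exact le_sq_mul_of_le_mul_sqrt hT0 hA0 (mul_nonneg hb hΛ) hODpair

/-! ## §4 ★★★ Family forms: the field `hOD` as hypothesis -/

/-- ★★★ **hOD ⇒ EVERY ORTHOGONALISED DEFECT IS SMALL (family form; converse of `hOD_of_defect`, p679261).**  For a profile family `Ω` (`|Ω| ≤ 1`, measurable), weights
`w_β = softWeight (χ β)` (measurable, bounded, `≥ 0`), a slow window `orbitDist < δ₁ β`, a level `Λ β ≥ 0` (eventually) and a rate `b β ≥ 0`: if the field `hOD` holds (weight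
`χ`, window `δ₁`, level `Λ`, rate `b`), then eventually, for every admissible `φ`, every bounded measurable `ψ` and every bounded measurable `E` supported in `{χ β ≠ 0}` and
fibrewise `w_β`-orthogonal to `Ω β` with `K̃(boFun φ (Ω β)) = (boFun ψ (Ω β) + E)·w_β` on `supp E`:  `∫ E²w_β ≤ (b β·Λ β)²·‖boFun φ (Ω β)‖²_{w_β}`.
[cite: Luscher1983, §3] [cite: SjostrandZworski2007, §2] -/
theorem defect_sq_le_of_hOD {Ω : ℝ → LinkSpace L → ℝ} (hΩm : ∀ β, Measurable (Ω β)) (hΩ1 : ∀ β x, |Ω β x| ≤ 1)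
    {χ : ℝ → GaugeConfig 3 L SU2 → ℝ} (hw : ∀ β, Measurable (softWeight (χ β)) ∧ (∃ C : ℝ, ∀ U, |softWeight (χ β) U| ≤ C) ∧ ∀ U, 0 ≤ softWeight (χ β) U)
    {δ₁ Λ b : ℝ → ℝ} (hΛ : ∀ᶠ β in atTop, 0 ≤ Λ β) (hb : ∀ β, 0 ≤ b β)
    (hOD : ∀ᶠ β in atTop, ∀ (φ : GaugeConfig 3 1 SU2 → ℝ) (v : GaugeConfig 3 L SU2 → ℝ), Measurable φ → (∃ C : ℝ, ∀ u, |φ u| ≤ C) →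
      (∀ u, φ u ≠ 0 → orbitDist u < δ₁ β) → Measurable v → (∃ C : ℝ, ∀ U, |v U| ≤ C) → (∀ U, v U ≠ 0 → χ β U ≠ 0) →
      (∀ u, fibreInner L (softWeight (χ β)) (Ω β) v u = 0) →
      |tubeCross β (boFun L φ (Ω β)) v| ≤ b β * Λ β * Real.sqrt (tubeNormSq (softWeight (χ β)) (boFun L φ (Ω β))) * Real.sqrt (tubeNormSq (softWeight (χ β)) v) ∧
      |tubeCross β v (boFun L φ (Ω β))| ≤ b β * Λ β * Real.sqrt (tubeNormSq (softWeight (χ β)) (boFun L φ (Ω β))) * Real.sqrt (tubeNormSq (softWeight (χ β)) v)) :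
    ∀ᶠ β in atTop, ∀ φ : GaugeConfig 3 1 SU2 → ℝ, Measurable φ → (∃ C : ℝ, ∀ u, |φ u| ≤ C) → (∀ u, φ u ≠ 0 → orbitDist u < δ₁ β) →
      ∀ (ψ : GaugeConfig 3 1 SU2 → ℝ) (E : GaugeConfig 3 L SU2 → ℝ), Measurable ψ → (∃ C : ℝ, ∀ u, |ψ u| ≤ C) → Measurable E → (∃ C : ℝ, ∀ U, |E U| ≤ C) →
      (∀ U, E U ≠ 0 → χ β U ≠ 0) → (∀ u, fibreInner L (softWeight (χ β)) (Ω β) E u = 0) →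
      (∀ U, E U ≠ 0 → ∫ V, avgKernel β U V * boFun L φ (Ω β) V ∂configMeasure SU2 L = (boFun L ψ (Ω β) U + E U) * softWeight (χ β) U) →
      ∫ U, E U ^ 2 * softWeight (χ β) U ∂configMeasure SU2 L ≤ (b β * Λ β) ^ 2 * tubeNormSq (softWeight (χ β)) (boFun L φ (Ω β)) := by
  filter_upwards [hOD, hΛ] with β hβ hΛβ φ hφm hφb hφs ψ E hψm hψb hEm hEb hEχ horth hF
  obtain ⟨Cψ, hCψ⟩ := hψb
  obtain ⟨CE, hCE⟩ := hEb
  obtain ⟨hwm, ⟨Cw, hCw⟩, hw0⟩ := hw β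
  obtain ⟨-, h2⟩ := hβ φ E hφm hφb hφs hEm ⟨CE, hCE⟩ hEχ horth
  exact defect_sq_le_of_hOD_pair β (hΩm β) (hΩ1 β) hwm hCw hw0 φ hEm hCE horth hψm hCψ hF (hb β) hΛβ h2

/-- ★★★ **hOD ⇒ NO LEAK (family form).**  Same data: if the field `hOD` holds, then eventually, for every admissible `φ` and every measurable
`S ⊆ {χ β ≠ 0} ∩ {Ω β ∘ relLinkVec = 0}` on which `w_β ≥ w₀ > 0`:  `∫_S K̃(boFun φ (Ω β))²/w_β ≤ (b β·Λ β)²·‖boFun φ (Ω β)‖²_{w_β}`.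
[cite: Luscher1983, §3] [cite: SjostrandZworski2007, §2] -/
theorem leak_sq_le_of_hOD {Ω : ℝ → LinkSpace L → ℝ} (hΩm : ∀ β, Measurable (Ω β)) (hΩ1 : ∀ β x, |Ω β x| ≤ 1)
    {χ : ℝ → GaugeConfig 3 L SU2 → ℝ} (hw : ∀ β, Measurable (softWeight (χ β)) ∧ (∃ C : ℝ, ∀ U, |softWeight (χ β) U| ≤ C) ∧ ∀ U, 0 ≤ softWeight (χ β) U)
    {δ₁ Λ b : ℝ → ℝ} (hΛ : ∀ᶠ β in atTop, 0 ≤ Λ β) (hb : ∀ β, 0 ≤ b β)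
    (hOD : ∀ᶠ β in atTop, ∀ (φ : GaugeConfig 3 1 SU2 → ℝ) (v : GaugeConfig 3 L SU2 → ℝ), Measurable φ → (∃ C : ℝ, ∀ u, |φ u| ≤ C) →
      (∀ u, φ u ≠ 0 → orbitDist u < δ₁ β) → Measurable v → (∃ C : ℝ, ∀ U, |v U| ≤ C) → (∀ U, v U ≠ 0 → χ β U ≠ 0) →
      (∀ u, fibreInner L (softWeight (χ β)) (Ω β) v u = 0) →
      |tubeCross β (boFun L φ (Ω β)) v| ≤ b β * Λ β * Real.sqrt (tubeNormSq (softWeight (χ β)) (boFun L φ (Ω β))) * Real.sqrt (tubeNormSq (softWeight (χ β)) v) ∧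
      |tubeCross β v (boFun L φ (Ω β))| ≤ b β * Λ β * Real.sqrt (tubeNormSq (softWeight (χ β)) (boFun L φ (Ω β))) * Real.sqrt (tubeNormSq (softWeight (χ β)) v)) :
    ∀ᶠ β in atTop, ∀ φ : GaugeConfig 3 1 SU2 → ℝ, Measurable φ → (∃ C : ℝ, ∀ u, |φ u| ≤ C) → (∀ u, φ u ≠ 0 → orbitDist u < δ₁ β) →
      ∀ S : Set (GaugeConfig 3 L SU2), MeasurableSet S → (∀ U ∈ S, χ β U ≠ 0) → (∀ U ∈ S, Ω β (relLinkVec L U) = 0) →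
      (∃ w₀ : ℝ, 0 < w₀ ∧ ∀ U ∈ S, w₀ ≤ softWeight (χ β) U) →
      ∫ U in S, (∫ V, avgKernel β U V * boFun L φ (Ω β) V ∂configMeasure SU2 L) ^ 2 / softWeight (χ β) U ∂configMeasure SU2 L ≤
        (b β * Λ β) ^ 2 * tubeNormSq (softWeight (χ β)) (boFun L φ (Ω β)) := by
  filter_upwards [hOD, hΛ] with β hβ hΛβ φ hφm hφb hφs S hS hSχ hSΩ hSw
  obtain ⟨w₀, hw₀, hSw⟩ := hSw
  obtain ⟨Cφ, hCφ⟩ := hφb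
  obtain ⟨hwm, -, hw0⟩ := hw β
  have hfm : Measurable (boFun L φ (Ω β)) := measurable_boFun L hφm (hΩm β)
  have hCf := abs_boFun_le L hCφ (hΩ1 β)
  obtain ⟨hvm, hvb, hvorth, -, -⟩ := leak_admissible β (Ω β) hwm hfm hCf hS hSΩ hw₀ hSw
  have hvχ : ∀ U, S.indicator (fun U => (∫ V, avgKernel β U V * boFun L φ (Ω β) V ∂configMeasure SU2 L) / softWeight (χ β) U) U ≠ 0 → χ β U ≠ 0 := by
    intro U hU
    by_cases hUS : U ∈ S
    · exact hSχ U hUS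
    · exact absurd (Set.indicator_of_notMem hUS _) hU
  obtain ⟨-, h2⟩ := hβ φ _ hφm ⟨Cφ, hCφ⟩ hφs hvm hvb hvχ hvorth
  exact leak_sq_le_of_hOD_pair β (Ω β) hwm hw0 hfm hCf hS hSΩ hw₀ hSw (hb β) hΛβ h2

/-! ## §5 ★★★ The record instances -/

/-- ★★★ **For every `RecordAnalyticInput`: `hOD` bounds every orthogonalised defect** (weight `softWeight (recordChi L s 43 M β)`, window `recordDelta1 L s β`, level `σ β·λ₀`,
rate `A.b β`). [cite: Luscher1983, §3] [cite: SjostrandZworski2007, §2] -/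
theorem record_defect_sq_le {s M : ℝ} (A : RecordAnalyticInput L s M) :
    ∀ᶠ β in atTop, ∀ φ : GaugeConfig 3 1 SU2 → ℝ, Measurable φ → (∃ C : ℝ, ∀ u, |φ u| ≤ C) → (∀ u, φ u ≠ 0 → orbitDist u < recordDelta1 L s β) →
      ∀ (ψ : GaugeConfig 3 1 SU2 → ℝ) (E : GaugeConfig 3 L SU2 → ℝ), Measurable ψ → (∃ C : ℝ, ∀ u, |ψ u| ≤ C) → Measurable E → (∃ C : ℝ, ∀ U, |E U| ≤ C) →
      (∀ U, E U ≠ 0 → recordChi L s 43 M β U ≠ 0) → (∀ u, fibreInner L (softWeight (recordChi L s 43 M β)) (A.Ω β) E u = 0) →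
      (∀ U, E U ≠ 0 → ∫ V, avgKernel β U V * boFun L φ (A.Ω β) V ∂configMeasure SU2 L = (boFun L ψ (A.Ω β) U + E U) * softWeight (recordChi L s 43 M β) U) →
      ∫ U, E U ^ 2 * softWeight (recordChi L s 43 M β) U ∂configMeasure SU2 L ≤
        (A.b β * (A.σ β * levelValue su2Rep 1 ((L : ℝ) ^ 3 * β) 0)) ^ 2 * tubeNormSq (softWeight (recordChi L s 43 M β)) (boFun L φ (A.Ω β)) :=
  defect_sq_le_of_hOD A.hΩm A.hΩ1 (χ := recordChi L s 43 M)
    (fun β => ⟨(softWeight_recordChi_props (L := L) s 43 M β).1, ⟨_, (softWeight_recordChi_props (L := L) s 43 M β).2.1⟩,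
      (softWeight_recordChi_props (L := L) s 43 M β).2.2.1⟩)
    (Λ := fun β => A.σ β * levelValue su2Rep 1 ((L : ℝ) ^ 3 * β) 0)
    (Filter.Eventually.of_forall fun β => mul_nonneg (A.hσ β).le (levelValue_zero_su2Rep_pos 1 _).le) A.hb A.hOD

/-- ★★★ **For every `RecordAnalyticInput`: `hOD` forbids leaking** — eventually, for every admissible `φ` and every measurable `S ⊆ {recordChi ≠ 0} ∩ {A.Ω β ∘ relLinkVec = 0}`
with `softWeight (recordChi …) ≥ w₀ > 0` on `S`:  `∫_S K̃(boFun φ (A.Ω β))²/w ≤ (A.b β·σ β·λ₀)²·‖boFun φ (A.Ω β)‖²_w`.  Since `A.hΩr` gives `A.Ω β x = 0` for `r β < ‖x‖`,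
every measurable `S ⊆ {recordChi ≠ 0} ∩ {r β < ‖relLinkVec U‖} ∩ {w ≥ w₀}` qualifies. [cite: Luscher1983, §3] [cite: SjostrandZworski2007, §2] -/
theorem record_leak_sq_le {s M : ℝ} (A : RecordAnalyticInput L s M) :
    ∀ᶠ β in atTop, ∀ φ : GaugeConfig 3 1 SU2 → ℝ, Measurable φ → (∃ C : ℝ, ∀ u, |φ u| ≤ C) → (∀ u, φ u ≠ 0 → orbitDist u < recordDelta1 L s β) →
      ∀ S : Set (GaugeConfig 3 L SU2), MeasurableSet S → (∀ U ∈ S, recordChi L s 43 M β U ≠ 0) → (∀ U ∈ S, A.Ω β (relLinkVec L U) = 0) →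
      (∃ w₀ : ℝ, 0 < w₀ ∧ ∀ U ∈ S, w₀ ≤ softWeight (recordChi L s 43 M β) U) →
      ∫ U in S, (∫ V, avgKernel β U V * boFun L φ (A.Ω β) V ∂configMeasure SU2 L) ^ 2 / softWeight (recordChi L s 43 M β) U ∂configMeasure SU2 L ≤
        (A.b β * (A.σ β * levelValue su2Rep 1 ((L : ℝ) ^ 3 * β) 0)) ^ 2 * tubeNormSq (softWeight (recordChi L s 43 M β)) (boFun L φ (A.Ω β)) :=
  leak_sq_le_of_hOD A.hΩm A.hΩ1 (χ := recordChi L s 43 M)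
    (fun β => ⟨(softWeight_recordChi_props (L := L) s 43 M β).1, ⟨_, (softWeight_recordChi_props (L := L) s 43 M β).2.1⟩,
      (softWeight_recordChi_props (L := L) s 43 M β).2.2.1⟩)
    (Λ := fun β => A.σ β * levelValue su2Rep 1 ((L : ℝ) ^ 3 * β) 0)
    (Filter.Eventually.of_forall fun β => mul_nonneg (A.hσ β).le (levelValue_zero_su2Rep_pos 1 _).le) A.hb A.hOD

/-- ★★ **The record shell is a leak set.**  For `A : RecordAnalyticInput L s M`, the profile factor vanishes on `{r β < ‖relLinkVec U‖}` (`A.hΩr`), so `record_leak_sq_le` applies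
to every measurable `S ⊆ {recordChi ≠ 0} ∩ {r β < ‖relLinkVec U‖} ∩ {w ≥ w₀}`. [folklore] -/
theorem record_profile_zero_of_lt_norm {s M : ℝ} (A : RecordAnalyticInput L s M) (β : ℝ) (U : GaugeConfig 3 L SU2) (hU : A.r β < ‖relLinkVec L U‖) :
    A.Ω β (relLinkVec L U) = 0 := by
  by_contra h
  exact absurd (A.hΩr β _ h) (not_le.mpr hU)

end Summit.QuantumFields.YangMills.Theorems.TwistedTraceScaling.Negative.R44

end
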